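import Literature.Probability.Percolation.ArmSeparationInnerFrames
import Literature.Probability.Percolation.ArmSeparationIntFrame
import HarnessLib

/-!
# Beacons: catching a fenced inner tip from the original frame

Topic: Probability / Percolation; family `crit-perc`. A brick of the discharge of
`Literature.Probability.Percolation.Nolin2008_twoArm_separation` (Nolin 2008, Thm. 11
[arXiv 0711.4948: Thm. 10], `j = 2`, `σ = BW`; `ArmSeparation.lean`), inward extension of the
fenced arms (Nolin 2008, Prop. 12 (iii)–(i) on the internal boundary: "once well-separated, the
arms can easily be extended", via RSW corridors and the generalised FKG inequality). A fenced
inner tip (`IntFencedArm`, `ArmSeparationInner.lean`) lives in the frame of its side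
(`frameIso i`, `ArmSeparationInnerFrames.lean`), where its free space is the axis-parallel box
`[m-2k, m-k] × [t+k, t+2k]` crossed vertically; the corridors of the extension step are
axis-parallel boxes of the ORIGINAL frame, and the frames `ρ, ρ⁴` do not map boxes to boxes.
The hand-over object is a **beacon**: the open frame `triFrameAt c' (k/2)` (square annulus of
four crossed strips, `ArmSeparationFrame.lean`) about the point `c' = (m - 2k + 1, T₀ + 2k + w)` of
the tip's frame, for a tip row `t ∈ [T₀, T₀ + w)` (`4w ≤ k`): its bottom strip crosses the free
space horizontally, hence meets the fence; and since the frames preserve the graph norm, every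
path of the original frame from the hexagonal ball `|v - c| ≤ k/2` about `c = frameIso i c'` to
`|v - c| ≥ 2k` is, back in the tip's frame, a path from the inner box of the beacon to outside its
outer box, hence meets the beacon (`FrameData.exists_mem_K`).

* `bcnCentre m k T₀ w`, `tipBox m t k` (a box of `Λ̊_m` above the tip row containing the free
  space, the fence zone and the beacon);
* `FrameData.pathIn_K` — the four crossings of a frame are connected;
* `beacon_catch` — **the catch**: for a fenced arm `Fo` in the frame `i` with tip row in the
  window, a beacon about `c'` realised by `frameConfig i ω`, and a tight open path of `ω` from
  `|p - c| ≤ k/2` to `|q - c| ≥ 2k` inside a set `S`, there is an open path of `ω` from `p` to the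
  far end `frameIso i Fo.b` of the arm inside `S ∪ frameIso i (A ∪ tipBox)`.

## References

* P. Nolin, *Near-critical percolation in two dimensions*, Electron. J. Probab. 13 (2008), §4.3
  Prop. 12, §4.4 (proof of Thm. 11, internal extremities) [arXiv 0711.4948: Prop. 11, Thm. 10]. [Nolin2008]
* H. Kesten, *Scaling relations for 2D-percolation*, Comm. Math. Phys. 109 (1987), Lemma 2 (fences). [Kesten1987]

Tree: `IntFencedArm` (`ArmSeparationInner.lean`); `frameIso`, `frameConfig`, `pathIn_frameConfig`,
`pathIn_of_frameConfig`, `frameIso_symm_sub`, `triNorm_frameIso_symm` (`ArmSeparationInnerFrames.lean`);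
`triFrameAt`, `FrameData`, `nonempty_frameData`, `exists_mem_K`, `pathIn_Y`, `K_subset`, `bounds*`
(`ArmSeparationFrame.lean`), `FrameData.exists_mem_SN_SE` (`ArmSeparationIntFrame.lean`);
`exists_mem_of_cross` (`ArmEventsAPriori.lean`); `PathIn.exists_support`.
-/

noncomputable section

open Set

namespace Literature.Probability.Percolation

open LatticeModels HalfAnnulus

/-! ### Frames are connected -/

namespace FrameData

variable {z : Site 2} {k : ℕ} {ω : SiteConfig (Site 2)} (F : FrameData z k ω)

/-- **The four crossings of a frame are connected**: any two sites of `K = N ∪ S ∪ W ∪ E` are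
joined inside `K` (`pathIn_Y` for `N ∪ S ∪ W`, and the right crossing meets the top one). [folklore] -/
theorem pathIn_K (hk : 1 ≤ k) {u v : Site 2} (hu : u ∈ F.K) (hv : v ∈ F.K) : PathIn triGraph F.K u v := by
  obtain ⟨p, hpN, hpE⟩ := F.exists_mem_SN_SE hk
  have hYK : F.Y ⊆ F.K := F.Y_subset_K
  have hEK : F.SE ⊆ F.K := fun _ h => Or.inr h
  have hpY : p ∈ F.Y := Or.inl (Or.inl hpN)
  have toY : ∀ w ∈ F.K, ∃ y ∈ F.Y, PathIn triGraph F.K w y := by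
    intro w hw
    rcases hw with hw | hw
    · exact ⟨w, hw, PathIn.refl (hYK hw)⟩
    · exact ⟨p, hpY, ((F.tightE w hw).symm.trans (F.tightE p hpE)).mono hEK⟩
  obtain ⟨yu, hyu, Pu⟩ := toY u hu
  obtain ⟨yv, hyv, Pv⟩ := toY v hv
  exact (Pu.trans ((F.pathIn_Y hk hyu hyv).mono hYK)).trans Pv.symm

end FrameData

/-! ### The beacon and the tip box -/

/-- **The centre of the beacon** of a tip in the window `[T₀, T₀ + w)` at scale `k` (tip's frame):
`c' = (m - 2k + 1, T₀ + 2k + w)`; the beacon is the open frame `triFrameAt c' (k/2)`, whose bottom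
strip `[c'₀ - k, c'₀ + k] × [c'₁ - k, c'₁ - k/2]` crosses the free space `[m-2k, m-k] × [t+k, t+2k]`
of every tip row `t` of the window horizontally. [cite: Nolin2008, §4.2 Def. 6–7 (free spaces) (arXiv 0711.4948)] -/
def bcnCentre (m k : ℕ) (T₀ : ℤ) (w : ℕ) : Site 2 := ![(m : ℤ) - 2 * k + 1, T₀ + 2 * k + w]

/-- **The tip box**: the sites `[m - 5k, m - 1] × (t, t + 4k]` of the tip's frame — inside
`Λ̊_m ∩ {x₀ ≥ 0}` when the tip row satisfies `t ≤ -4k`, above the tip row, containing the free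
space, the interior part of the fence zone and the beacon. [cite: Nolin2008, §4.2 Def. 6–7 (free spaces) (arXiv 0711.4948)] -/
def tipBox (m : ℕ) (t : ℤ) (k : ℕ) : Set (Site 2) :=
  {v | (m : ℤ) - 5 * k ≤ v 0 ∧ v 0 ≤ (m : ℤ) - 1 ∧ t < v 1 ∧ v 1 ≤ t + 4 * k}

/-- Membership in the tip box. [folklore] -/
@[simp] theorem mem_tipBox {m k : ℕ} {t : ℤ} {v : Site 2} :
    v ∈ tipBox m t k ↔ (m : ℤ) - 5 * k ≤ v 0 ∧ v 0 ≤ (m : ℤ) - 1 ∧ t < v 1 ∧ v 1 ≤ t + 4 * k := Iff.rfl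

/-- The tip box lies inside `Λ̊_m ∩ {x₀ ≥ 0}` when `-m + k ≤ t`, `t + 4k ≤ 0` and `5k ≤ m`. [folklore] -/
theorem tipBox_subset {m k : ℕ} {t : ℤ} (h1 : -(m : ℤ) + k ≤ t) (h2 : t + 4 * k ≤ 0) (h3 : 5 * k ≤ m) :
    ∀ v ∈ tipBox m t k, 0 ≤ v 0 ∧ triNorm v < m := by
  intro v hv
  rw [mem_tipBox] at hv
  have h3' : 5 * (k : ℤ) ≤ m := by exact_mod_cast h3
  exact ⟨by omega, triNorm_lt_iff_lin.2 (by omega)⟩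

/-! ### The catch -/

/-- **Catching a fenced inner tip through its beacon.** Let `Fo` be a fenced arm of
`frameConfig i ω` (`i < 6`) in a region `A ⊇ HA(m)`, with scale `k = k₀ · 32^j ≥ 4` and tip row
`t ∈ [T₀, T₀ + w)` (`4w ≤ k`), and suppose `frameConfig i ω` realises the
beacon `triFrameAt c' (k/2)`, `c' = bcnCentre m k T₀ w`. Let `S ⊆ ω` carry an open path from `p` to
`q`, star-shaped from `p`, with `|p - c|_𝕋 ≤ k/2` and `|q - c|_𝕋 ≥ 2k`, `c = frameIso i c'`. Then
`p` is joined to the far end `frameIso i Fo.b` of the arm by an open path of `ω` inside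
`S ∪ frameIso i (A ∪ tipBox m t k)`: in the tip's frame the path meets the beacon
(`FrameData.exists_mem_K`), the beacon's bottom strip meets the free space crossing through
`Fo.mm` (`exists_mem_of_cross`), and `Fo.mm` is joined to `Fo.b` (`Fo.path`). [cite: Nolin2008, §4.3 Prop. 12 (proof) and §4.4 (arXiv 0711.4948: Prop. 11, Thm. 10)] -/
theorem beacon_catch {m k₀ K R₀ : ℕ} {A : Set (Site 2)} (hHA : haSet m ⊆ A) {i : ℕ} (hi : i < 6) {ω : SiteConfig (Site 2)}
    (Fo : IntFencedArm m A k₀ K R₀ (frameConfig i ω)) {T₀ : ℤ} {w : ℕ} (hwk : 4 * w ≤ Fo.k) (hk : 4 ≤ Fo.k)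
    (hwin : T₀ ≤ Fo.z 1 ∧ Fo.z 1 < T₀ + w)
    (hB : frameConfig i ω ∈ triFrameAt (bcnCentre m Fo.k T₀ w) (Fo.k / 2))
    {S : Set (Site 2)} (hS : S ⊆ ω) {p q : Site 2} (hP : PathIn triGraph S p q) (hstar : ∀ v ∈ S, PathIn triGraph S p v)
    (hp : triNorm (p - frameIso i (bcnCentre m Fo.k T₀ w)) ≤ (Fo.k / 2 : ℕ))
    (hq : 2 * (Fo.k : ℤ) ≤ triNorm (q - frameIso i (bcnCentre m Fo.k T₀ w))) :
    PathIn triGraph ((S ∪ frameIso i '' (A ∪ tipBox m (Fo.z 1) Fo.k)) ∩ ω) p (frameIso i Fo.b) := by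
  have hk1 : 1 ≤ Fo.k / 2 := by omega
  have hkk : 2 * ((Fo.k / 2 : ℕ) : ℤ) ≤ Fo.k ∧ (Fo.k : ℤ) ≤ 2 * ((Fo.k / 2 : ℕ) : ℤ) + 1 := by omega
  have hwk' : 4 * (w : ℤ) ≤ Fo.k := by exact_mod_cast hwk
  have hk4 : (4 : ℤ) ≤ Fo.k := by exact_mod_cast hk
  obtain ⟨c', hc'⟩ : ∃ c' : Site 2, c' = bcnCentre m Fo.k T₀ w := ⟨_, rfl⟩
  rw [← hc'] at hB hp hq
  have hc'0 : c' 0 = (m : ℤ) - 2 * Fo.k + 1 := by rw [hc']; exact site_mk_apply_zero _ _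
  have hc'1 : c' 1 = T₀ + 2 * Fo.k + w := by rw [hc']; exact site_mk_apply_one _ _
  obtain ⟨hz0, hz1, hz2⟩ := Fo.z_isIntJ
  -- (1) the fence through `mm`, with a support star-shaped from `mm`
  obtain ⟨bb, tt, hbb, htt, P1, P2⟩ := Fo.tipOK.1
  obtain ⟨Sa, hSa, Pa, Ta⟩ := P1.symm.exists_support
  obtain ⟨Sb, hSb, Pb, Tb⟩ := P2.exists_support
  have hkj : ((trapScale k₀ Fo.j : ℕ) : ℤ) = Fo.k := rfl
  have Tf : ∀ v ∈ Sa ∪ Sb, PathIn triGraph (Sa ∪ Sb) Fo.mm v := by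
    rintro v (hv | hv)
    · exact (Ta v hv).mono subset_union_left
    · exact (Tb v hv).mono subset_union_right
  have Pf : PathIn triGraph (Sa ∪ Sb) bb tt := (Tf bb (Or.inl Pa.right_mem)).symm.trans (Tf tt (Or.inr Pb.right_mem))
  have hSf : ∀ v ∈ Sa ∪ Sb, ((m : ℤ) - 2 * Fo.k ≤ v 0 ∧ v 0 ≤ (m : ℤ) - Fo.k ∧ (Fo.z 1) + Fo.k ≤ v 1 ∧ v 1 ≤ (Fo.z 1) + 2 * Fo.k) ∧ v ∈ (frameConfig i ω) := by
    rintro v hv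
    have h := (Set.union_subset hSa hSb) hv
    obtain ⟨h1, h2⟩ := h
    rw [mem_triStrip, hkj, hz0] at h1
    exact ⟨by omega, h2⟩
  -- (2) the beacon; its bottom strip meets the fence
  obtain ⟨F⟩ := nonempty_frameData hB
  obtain ⟨v₁, hv₁S, hv₁f⟩ := exists_mem_of_cross (L := (m : ℤ) - 2 * Fo.k) (R := (m : ℤ) - Fo.k) (B := (Fo.z 1) + Fo.k) (T := (Fo.z 1) + 2 * Fo.k)
    (by omega) (by omega) F.pathS (by rw [F.xS0, hc'0]; omega) (by rw [F.yS0, hc'0]; omega)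
    (fun v hv _ _ => by have := F.boundsS hv; rw [hc'1] at this; omega)
    Pf (by rw [hbb, hkj]) (by rw [htt, hkj]) (fun v hv _ _ => ⟨(hSf v hv).1.1, (hSf v hv).1.2.1⟩)
  have hv₁K : v₁ ∈ F.K := Or.inl (Or.inl (Or.inr hv₁S))
  have toMM : ∀ x ∈ F.K, PathIn triGraph (F.K ∪ (Sa ∪ Sb)) x Fo.mm := fun x hx =>
    ((F.pathIn_K hk1 hx hv₁K).mono subset_union_left).trans ((Tf v₁ hv₁f).symm.mono subset_union_right)
  -- (3) the original path, read in the tip's frame, pierces the beacon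
  set S' : Set (Site 2) := (frameIso i).symm '' S with hS'
  have hP' : PathIn triGraph (S ∩ {v | v ∈ ω ↔ true}) p q := hP.mono fun v hv => ⟨hv, by simpa using hS hv⟩
  have P' := pathIn_frameConfig i hP'
  have star' : ∀ y ∈ S' ∩ {v | v ∈ (frameConfig i ω) ↔ true}, PathIn triGraph (S' ∩ {v | v ∈ (frameConfig i ω) ↔ true}) ((frameIso i).symm p) y := by
    rintro y ⟨⟨v, hv, rfl⟩, -⟩
    exact pathIn_frameConfig i ((hstar v hv).mono fun u hu => ⟨hu, by simpa using hS hu⟩)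
  have hsub : ∀ a : Site 2, (frameIso i).symm a - c' = (frameIso i).symm (a - frameIso i c') := fun a => by
    rw [frameIso_symm_sub i hi, RelIso.symm_apply_apply]
  have hp' : triNorm ((frameIso i).symm p - c') ≤ ((Fo.k / 2 : ℕ) : ℤ) := by
    rw [hsub, triNorm_frameIso_symm i hi]; exact hp
  have hq' : 2 * (Fo.k : ℤ) ≤ triNorm ((frameIso i).symm q - c') := by
    rw [hsub, triNorm_frameIso_symm i hi]; exact hq
  have hpl := triNorm_le_iff_lin.1 hp'
  have hql := le_triNorm_iff_lin.1 hq'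
  simp only [Pi.sub_apply] at hpl hql
  obtain ⟨x, hxS, hxK⟩ := F.exists_mem_K hk1 (s := (frameIso i).symm p) (t := (frameIso i).symm q)
    (by omega) (by omega) P'
  -- (4) assemble in the tip's frame
  set R : Set (Site 2) := (S' ∪ (A ∪ tipBox m (Fo.z 1) Fo.k)) ∩ {v | v ∈ (frameConfig i ω) ↔ true} with hR
  have hKR : F.K ∪ (Sa ∪ Sb) ⊆ R := by
    rintro v (hv | hv)
    · have hb := F.boundsK hv
      rw [hc'0, hc'1] at hb
      refine ⟨Or.inr (Or.inr ⟨by omega, by omega, by omega, by omega⟩), by simpa using F.K_subset hv⟩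
    · obtain ⟨hb, hvχ⟩ := hSf v hv
      exact ⟨Or.inr (Or.inr ⟨by omega, by omega, by omega, by omega⟩), by simpa using hvχ⟩
  have hZR : (A ∪ intFrameZone m Fo.z Fo.k) ∩ (frameConfig i ω) ⊆ R := by
    rintro v ⟨hv | hv, hvχ⟩
    · exact ⟨Or.inr (Or.inl hv), by simpa using hvχ⟩
    · rw [mem_intFrameZone] at hv
      obtain ⟨h1, h2, h3, h4, h5⟩ := hv
      rcases h1 with h1 | ⟨h1, h1'⟩
      · exact ⟨Or.inr (Or.inl (hHA h1)), by simpa using hvχ⟩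
      · rw [mem_hinSet] at h1
        have := triNorm_lt_iff_lin.1 h1.2
        refine ⟨Or.inr (Or.inr ⟨by omega, by omega, by omega, by omega⟩), by simpa using hvχ⟩
  have Q1 : PathIn triGraph R ((frameIso i).symm p) x := (star' x hxS).mono fun v hv => ⟨Or.inl hv.1, hv.2⟩
  have Q2 : PathIn triGraph R x Fo.mm := (toMM x hxK).mono hKR
  have Q3 : PathIn triGraph R Fo.mm Fo.b := Fo.path.symm.mono hZR
  -- (5) back to the original frame
  have Q := pathIn_of_frameConfig i ((Q1.trans Q2).trans Q3)
  rw [RelIso.apply_symm_apply] at Q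
  refine Q.mono ?_
  rintro v ⟨⟨u, hu, rfl⟩, hvω⟩
  refine ⟨?_, by simpa using hvω⟩
  rcases hu with ⟨v, hv, rfl⟩ | hu
  · left; rw [RelIso.apply_symm_apply]; exact hv
  · exact Or.inr ⟨u, hu, rfl⟩

end Literature.Probability.Percolation
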